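import Summits.CriticalPhenomena.PercolationContinuityZ3.Theorems.PercNearOneGluingNoHeavyPcintTFibFactor
import HarnessLib

/-!
# PCINT lane, T-fibre route PHASE 2, step (2U): the usable-set fibre process on `𝕋 × F`

Cell `prim-pcint`, seat `prim-pcint-1` (gen 12); memo `run/shared/lean/prim/pcint/T-FIBRE-ROUTE.md` (PHASE 2).

Generalisation of the fibre process of `…PcintTFibProcess.lean` (clique fibres `K_m`) to an ARBITRARY finite fibre
graph `F` on a type `Φ` (the lattice is the box product `𝕋 × F`, `TFib.boxGraphT` on the base): the state of the
fibre above a site `v ∈ Λ ⊆ 𝕋` is `w v : Φ → Bool`, and a site revealed TRUE by the exploration carries a USABLE SET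
`U_v ⊆ Φ` of fibre cells known to be joined to the root cell `(o, i₀)`:

* root rule: all cells of the fibre of `o` open, `U_o = Φ`;
* a child `a` of the selected parent `c` is REACHED iff some cell of `U_c` is open in `a` (`meetsU (w a) U_c`), and then
  `U_a = υ (w a) U_c` for a USABLE-SET RULE `υ : (Φ → Bool) → Finset Φ → Finset Φ` (for instance: the union of the open
  `F`-components of `w a` meeting `U_c`; for complete bipartite fibres a closed form, `…PcintUFibKnn.lean`).

Since `U_c` depends on the history (the chain of examiners back to the root), the oracle `outU` computes it by REPLAYING
the current state (`AdaptDom.readOut`, as in `TFib.traj`): `usableX w x k v` is the usable set of `v` after `k` steps of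
the run with value oracle `x`, and `usableAt w σ b = usableX w (readOut σ) (|Λ|+1) b`.  This file proves the calculus of
these sets (`usableX_stable`, `usableX_congr`, `usableAt_run`) and the SOUNDNESS of the process: if `υ` only returns open
cells joined inside the fibre to an open cell of the parent set (`hυ₁`, `hυ₂`) and `F` is connected from `i₀`, every site
revealed true carries open `𝕋 × F`-paths from `(o, i₀)` to all cells of its usable set (`pathIn_of_run`), whence
`exists_pathIn_of_reach`.  Theorems only; no new facts, no `sorry`.
-/

noncomputable section

namespace Summit.CriticalPhenomena.PercolationContinuityZ3.Theorems.Pcint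

/-! ### A run and the replay of one of its states agree on the common prefix -/

namespace AdaptDom

variable {V : Type*} [Fintype V] [DecidableEq V]

omit [Fintype V] in
/-- **Prefix agreement**: the replay of the state `run R x n` coincides with the run itself up to step `n`. -/
theorem run_readOut_run {R : (V → Option Bool) → Finset V} (hR : ∀ σ v, v ∈ R σ → σ v = none)
    (x : (V → Option Bool) → V → Bool) (n : ℕ) : ∀ k ≤ n, run R (readOut (run R x n)) k = run R x k := by
  have h := (run_eq_iff_replay hR x n (run R x n)).1 rfl
  -- `h.1 : run R (readOut σ) n = σ`, `h.2 : x agrees with σ on examined sites of the replay`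
  intro k hk
  induction k with
  | zero => rfl
  | succ k ih =>
    have ih' := ih (Nat.le_of_succ_le hk)
    change stepPA (R (run R (readOut (run R x n)) k)) (run R (readOut (run R x n)) k)
        (readOut (run R x n) (run R (readOut (run R x n)) k)) =
      stepPA (R (run R x k)) (run R x k) (x (run R x k))
    have hval : ∀ a ∈ R (run R (readOut (run R x n)) k),
        x (run R (readOut (run R x n)) k) a = (run R x n a).getD false := fun a ha => h.2 k (Nat.lt_of_succ_le hk) a ha
    funext v
    unfold stepPA
    by_cases hv : v ∈ R (run R (readOut (run R x n)) k)
    · rw [if_pos hv, ih'] at *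
      rw [if_pos (by rw [← ih']; exact hv)]
      have := hval v hv
      rw [ih'] at this
      rw [this]; rfl
    · rw [if_neg hv, ih'] at *
      rw [if_neg (by rw [← ih']; exact hv)]

end AdaptDom

namespace UFib

open Finset AdaptDom ClusterExpl TFib Literature.Probability.Percolation Literature.Probability.LatticeModels

variable {Φ : Type*} [Fintype Φ]

/-! ### Fibre states, the reach test, usable sets -/

/-- The all-open fibre state (root rule). -/
def uAll : Φ → Bool := fun _ => true

/-- **The reach test**: the fibre state `y` MEETS the usable set `U` if some cell of `U` is open in `y`. -/
def meetsU (y : Φ → Bool) (U : Finset Φ) : Bool := decide (∃ i ∈ U, y i = true)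

omit [Fintype Φ] in
/-- `meetsU y U = true` iff some cell of `U` is open in `y`. -/
theorem meetsU_eq_true_iff {y : Φ → Bool} {U : Finset Φ} : meetsU y U = true ↔ ∃ i ∈ U, y i = true := by
  simp [meetsU]

variable (υ : (Φ → Bool) → Finset Φ → Finset Φ) (Λ : Finset (Site 2)) (enc : ↥Λ → ℕ) (o : ↥Λ)

/-- **Usable sets along a run** of the exploration rule with value oracle `x`: after `k` steps, the usable set of `v`.
A site examined at step `k` from the selected site `b` receives `υ (w v) (usable set of b)`; the root receives `Φ`;
other sites keep their set (unexamined sites have `∅`, a junk value never read). -/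
def usableX (w : ↥Λ → (Φ → Bool)) (x : (↥Λ → Option Bool) → ↥Λ → Bool) : ℕ → ↥Λ → Finset Φ
  | 0 => fun _ => ∅
  | k + 1 => fun v =>
      if v ∈ rule (boxGraphT Λ) enc o (run (rule (boxGraphT Λ) enc o) x k) then
        (if ∀ u, run (rule (boxGraphT Λ) enc o) x k u = none then (Finset.univ : Finset Φ)
         else match sel (boxGraphT Λ) enc (run (rule (boxGraphT Λ) enc o) x k) with
           | none => ∅
           | some b => υ (w v) (usableX w x k b))
      else usableX w x k v

/-- **The usable set read by the oracle** at state `σ`: replay `σ` for `|Λ| + 1` steps. -/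
def usableAt (w : ↥Λ → (Φ → Bool)) (σ : ↥Λ → Option Bool) (b : ↥Λ) : Finset Φ :=
  usableX υ Λ enc o w (readOut σ) (Fintype.card ↥Λ + 1) b

/-- **The usable-set fibre oracle**: at the root step report `[w o = uAll]`; afterwards report whether the fibre of
the examined site meets the usable set of the selected site. -/
def outU (w : ↥Λ → (Φ → Bool)) (σ : ↥Λ → Option Bool) (a : ↥Λ) : Bool :=
  if ∀ v, σ v = none then decide (w a = uAll)
  else match sel (boxGraphT Λ) enc σ with
    | none => false
    | some b => meetsU (w a) (usableAt υ Λ enc o w σ b)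

variable {υ Λ enc o}

/-- At the initial state the oracle reports `[w a = uAll]`. -/
theorem outU_init (w : ↥Λ → (Φ → Bool)) {τ : ↥Λ → Option Bool} (h : ∀ v, τ v = none) (a : ↥Λ) :
    outU υ Λ enc o w τ a = decide (w a = uAll) := by
  unfold outU; rw [if_pos h]

/-- At a non-initial state with no selected site the oracle reports `false`. -/
theorem outU_none (w : ↥Λ → (Φ → Bool)) {τ : ↥Λ → Option Bool} (h : ¬ ∀ v, τ v = none)
    (hsel : sel (boxGraphT Λ) enc τ = none) (a : ↥Λ) : outU υ Λ enc o w τ a = false := by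
  unfold outU; rw [if_neg h, hsel]

/-- At a non-initial state with selected site `b` the oracle reports `meetsU (w a) (usableAt w τ b)`. -/
theorem outU_sel (w : ↥Λ → (Φ → Bool)) {τ : ↥Λ → Option Bool} (h : ¬ ∀ v, τ v = none) {b : ↥Λ}
    (hsel : sel (boxGraphT Λ) enc τ = some b) (a : ↥Λ) :
    outU υ Λ enc o w τ a = meetsU (w a) (usableAt υ Λ enc o w τ b) := by
  unfold outU; rw [if_neg h, hsel]

/-! ### The calculus of usable sets -/

section Calculus

variable (w : ↥Λ → (Φ → Bool)) (x : (↥Λ → Option Bool) → ↥Λ → Bool)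

/-- A site not examined at step `k` keeps its usable set. -/
theorem usableX_succ_of_not_mem {k : ℕ} {v : ↥Λ} (hv : v ∉ rule (boxGraphT Λ) enc o (run (rule (boxGraphT Λ) enc o) x k)) :
    usableX υ Λ enc o w x (k + 1) v = usableX υ Λ enc o w x k v := by
  simp only [usableX]; rw [if_neg hv]

/-- At the root step the examined site (the root) receives `Φ`. -/
theorem usableX_succ_of_init {k : ℕ} {v : ↥Λ} (hv : v ∈ rule (boxGraphT Λ) enc o (run (rule (boxGraphT Λ) enc o) x k))
    (hinit : ∀ u, run (rule (boxGraphT Λ) enc o) x k u = none) :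
    usableX υ Λ enc o w x (k + 1) v = Finset.univ := by
  simp only [usableX]; rw [if_pos hv, if_pos hinit]

/-- A site examined at a non-initial step from the selected site `b` receives `υ (w v) (usable set of b)`. -/
theorem usableX_succ_of_sel {k : ℕ} {v : ↥Λ} (hv : v ∈ rule (boxGraphT Λ) enc o (run (rule (boxGraphT Λ) enc o) x k))
    (hne : ¬ ∀ u, run (rule (boxGraphT Λ) enc o) x k u = none) {b : ↥Λ}
    (hsel : sel (boxGraphT Λ) enc (run (rule (boxGraphT Λ) enc o) x k) = some b) :
    usableX υ Λ enc o w x (k + 1) v = υ (w v) (usableX υ Λ enc o w x k b) := by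
  simp only [usableX]; rw [if_pos hv, if_neg hne, hsel]

/-- **Stability**: the usable set of a site examined at step `k₀` does not change after step `k₀ + 1`. -/
theorem usableX_stable {k₀ : ℕ} {v : ↥Λ} (hv : v ∈ rule (boxGraphT Λ) enc o (run (rule (boxGraphT Λ) enc o) x k₀)) :
    ∀ k, k₀ + 1 ≤ k → usableX υ Λ enc o w x k v = usableX υ Λ enc o w x (k₀ + 1) v := by
  intro k hk
  induction k with
  | zero => exact absurd hk (by omega)
  | succ k ih =>
    rcases Nat.lt_or_eq_of_le hk with h | h
    · have hne : v ∉ rule (boxGraphT Λ) enc o (run (rule (boxGraphT Λ) enc o) x k) := fun h' => by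
        have := step_unique_of_mem_rule (boxGraphT Λ) enc o x hv h'
        omega
      rw [usableX_succ_of_not_mem w x hne]
      exact ih (by omega)
    · rw [h]

/-- An unexamined site has the junk usable set `∅`. -/
theorem usableX_eq_empty_of_forall_not_mem {k : ℕ} {v : ↥Λ}
    (hv : ∀ j < k, v ∉ rule (boxGraphT Λ) enc o (run (rule (boxGraphT Λ) enc o) x j)) :
    usableX υ Λ enc o w x k v = ∅ := by
  induction k with
  | zero => rfl
  | succ k ih =>
    rw [usableX_succ_of_not_mem w x (hv k (Nat.lt_succ_self k))]
    exact ih fun j hj => hv j (hj.trans (Nat.lt_succ_self k))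

/-- **Prefix congruence**: usable sets after `k` steps depend only on the states before step `k`. -/
theorem usableX_congr {x x' : (↥Λ → Option Bool) → ↥Λ → Bool} {k : ℕ}
    (h : ∀ j < k, run (rule (boxGraphT Λ) enc o) x j = run (rule (boxGraphT Λ) enc o) x' j) :
    usableX υ Λ enc o w x k = usableX υ Λ enc o w x' k := by
  induction k with
  | zero => rfl
  | succ k ih =>
    have ih' := ih fun j hj => h j (hj.trans (Nat.lt_succ_self k))
    have hk := h k (Nat.lt_succ_self k)
    funext v
    simp only [usableX]
    rw [hk, ih']

/-- **The oracle's usable set along a run**: at the state of step `n`, the usable set read for a site `b` examined at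
an earlier step `k₀ < n` is its run value `usableX w x (k₀ + 1) b`. -/
theorem usableAt_run {n k₀ : ℕ} (hk₀ : k₀ < n) {b : ↥Λ}
    (hb : b ∈ rule (boxGraphT Λ) enc o (run (rule (boxGraphT Λ) enc o) x k₀)) :
    usableAt υ Λ enc o w (run (rule (boxGraphT Λ) enc o) x n) b = usableX υ Λ enc o w x (k₀ + 1) b := by
  unfold usableAt
  set σ := run (rule (boxGraphT Λ) enc o) x n with hσ
  have hpre := run_readOut_run (rule_unrevealed (boxGraphT Λ) enc o) x n
  -- `b` is examined at step `k₀` of the replay as well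
  have hb' : b ∈ rule (boxGraphT Λ) enc o (run (rule (boxGraphT Λ) enc o) (readOut σ) k₀) := by
    rw [hpre k₀ hk₀.le]; exact hb
  rw [usableX_stable w (readOut σ) hb' (Fintype.card ↥Λ + 1) ?_]
  · exact congrFun (usableX_congr w fun j hj => hpre j (by omega)) b
  · -- `k₀ + 1 ≤ |Λ| + 1`: at step `k₀ + 1 ≤ n` at least `k₀ + 1` sites are revealed
    rcases nrev_run_ge (boxGraphT Λ) enc o x k₀ with ⟨k, hk, hke⟩ | hge
    · exfalso
      have := run_eq_of_terminal (boxGraphT Λ) enc o x hke k₀ hk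
      rw [this, hke] at hb
      simp at hb
    · have : nrev (run (rule (boxGraphT Λ) enc o) x (k₀ + 1)) ≤ Fintype.card ↥Λ := by
        unfold nrev; exact card_le_univ _
      omega

/-- Along a run, the usable set read at step `n` for `b` examined at `k₀ < n` is also `usableX w x n b`. -/
theorem usableAt_run' {n k₀ : ℕ} (hk₀ : k₀ < n) {b : ↥Λ}
    (hb : b ∈ rule (boxGraphT Λ) enc o (run (rule (boxGraphT Λ) enc o) x k₀)) :
    usableAt υ Λ enc o w (run (rule (boxGraphT Λ) enc o) x n) b = usableX υ Λ enc o w x n b := by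
  rw [usableAt_run w x hk₀ hb, usableX_stable w x hb n (by omega)]

end Calculus

/-! ### The lattice `𝕋 × F`, its configurations, and the soundness of the process -/

section Sound

variable (FA : SimpleGraph Φ)

/-- **The fibre lattice `𝕋 × F`**: box product of the triangular lattice with the fibre graph. -/
abbrev lfib : SimpleGraph (Site 2 × Φ) := triGraph □ FA

omit [Fintype Φ] in
/-- Adjacency in `𝕋 × F`, unfolded. -/
theorem lfib_adj {a b : Site 2 × Φ} :
    (lfib FA).Adj a b ↔ (triGraph.Adj a.1 b.1 ∧ a.2 = b.2) ∨ (a.1 = b.1 ∧ FA.Adj a.2 b.2) := by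
  rw [SimpleGraph.boxProd_adj]
  constructor
  · rintro (⟨h1, h2⟩ | ⟨h1, h2⟩)
    · exact Or.inl ⟨h1, h2⟩
    · exact Or.inr ⟨h2, h1⟩
  · rintro (⟨h1, h2⟩ | ⟨h1, h2⟩)
    · exact Or.inl ⟨h1, h2⟩
    · exact Or.inr ⟨h2, h1⟩

omit [Fintype Φ] in
/-- Adjacency in `𝕋 × F` is decidable. -/
instance instDecidableRelLfibAdj [DecidableEq Φ] [DecidableRel FA.Adj] : DecidableRel (lfib FA).Adj := fun a b =>
  decidable_of_iff _ (lfib_adj FA (a := a) (b := b)).symm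

variable (Λ) in
/-- The `𝕋 × F` site configuration of a fibre-state assignment: the open fibre cells above `Λ`. -/
def cfgU (w : ↥Λ → (Φ → Bool)) : Set (Site 2 × Φ) := {s | ∃ v : ↥Λ, s.1 = v.1 ∧ w v s.2 = true}

omit [Fintype Φ] in
/-- A fibre cell above `v ∈ Λ` is open iff the corresponding bit is set. -/
theorem mk_mem_cfgU_iff {w : ↥Λ → (Φ → Bool)} {v : ↥Λ} {i : Φ} : (v.1, i) ∈ cfgU Λ w ↔ w v i = true := by
  constructor
  · rintro ⟨u, hu, h⟩
    have : u = v := Subtype.ext hu.symm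
    subst this; exact h
  · intro h; exact ⟨v, rfl, h⟩

omit [Fintype Φ] in
/-- An open `F`-path inside one fibre is an open `𝕋 × F`-path. -/
theorem pathIn_fibre {w : ↥Λ → (Φ → Bool)} {v : ↥Λ} {i j : Φ} (hi : w v i = true)
    (h : Relation.ReflTransGen (fun a b => FA.Adj a b ∧ w v b = true) i j) :
    PathIn (lfib FA) (cfgU Λ w) (v.1, i) (v.1, j) := by
  induction h with
  | refl => exact PathIn.refl (mk_mem_cfgU_iff.2 hi)
  | @tail b c _ hbc ih =>
    exact ih.tail ((lfib_adj FA).2 (Or.inr ⟨rfl, hbc.1⟩)) (mk_mem_cfgU_iff.2 hbc.2)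

variable {FA}
variable (i₀ : Φ)
  (hυ₁ : ∀ (y : Φ → Bool) (H : Finset Φ) (j : Φ), j ∈ υ y H → y j = true)
  (hυ₂ : ∀ (y : Φ → Bool) (H : Finset Φ) (j : Φ), j ∈ υ y H →
    ∃ i ∈ H, y i = true ∧ Relation.ReflTransGen (fun a b => FA.Adj a b ∧ y b = true) i j)
  (hconn : ∀ j, Relation.ReflTransGen FA.Adj i₀ j)
include hυ₁ hυ₂ hconn

/-- **Soundness of the usable-set process**: along the run, a site `v` revealed true after `n` steps (i) forces the
root fibre all-open, (ii) has an open `𝕋 × F`-path from `(o, i₀)` to some cell of its fibre, and (iii) if it was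
examined at step `k`, every cell of its usable set `usableX w (outU w) (k+1) v` is open in `v` and joined to `(o, i₀)`
by an open `𝕋 × F`-path inside `cfgU w`. -/
theorem pathIn_of_run (w : ↥Λ → (Φ → Bool)) :
    ∀ (n : ℕ) (v : ↥Λ), run (rule (boxGraphT Λ) enc o) (outU υ Λ enc o w) n v = some true →
      w o = uAll ∧ (∃ j, PathIn (lfib FA) (cfgU Λ w) (o.1, i₀) (v.1, j)) ∧
        ∀ k, v ∈ rule (boxGraphT Λ) enc o (run (rule (boxGraphT Λ) enc o) (outU υ Λ enc o w) k) →
          ∀ j ∈ usableX υ Λ enc o w (outU υ Λ enc o w) (k + 1) v,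
            w v j = true ∧ PathIn (lfib FA) (cfgU Λ w) (o.1, i₀) (v.1, j)
  | 0, v, hv => by simp [run] at hv
  | n + 1, v, hv => by
    set x := outU υ Λ enc o w with hx
    set τ := run (rule (boxGraphT Λ) enc o) x n with hτ
    change stepPA (rule (boxGraphT Λ) enc o τ) τ (x τ) v = some true at hv
    unfold stepPA at hv
    by_cases hvR : v ∈ rule (boxGraphT Λ) enc o τ
    · rw [if_pos hvR, Option.some.injEq] at hv
      -- any examination step of `v` is the present one
      have hk : ∀ k, v ∈ rule (boxGraphT Λ) enc o (run (rule (boxGraphT Λ) enc o) x k) → k = n :=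
        fun k hk => step_unique_of_mem_rule (boxGraphT Λ) enc o x hk hvR
      by_cases hinit : ∀ u, τ u = none
      · -- root step: `v = o`, all cells open, usable set `Φ`
        rw [hx, outU_init w hinit, decide_eq_true_eq] at hv
        have hR : rule (boxGraphT Λ) enc o τ = {o} := by rw [rule, if_pos hinit]
        rw [hR, mem_singleton] at hvR
        rw [hvR] at hv ⊢
        have hall : ∀ j, w o j = true := fun j => by rw [hv]; rfl
        have hrtg : ∀ j, Relation.ReflTransGen (fun a b => FA.Adj a b ∧ w o b = true) i₀ j := fun j => by
          induction hconn j with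
          | refl => exact Relation.ReflTransGen.refl
          | tail _ hab ih => exact ih.tail ⟨hab, hall _⟩
        have hpath : ∀ j, PathIn (lfib FA) (cfgU Λ w) (o.1, i₀) (o.1, j) := fun j =>
          pathIn_fibre FA (hall i₀) (hrtg j)
        exact ⟨hv, ⟨i₀, hpath i₀⟩, fun k _ j _ => ⟨hall j, hpath j⟩⟩
      · cases hsel : sel (boxGraphT Λ) enc τ with
        | none => rw [hx, outU_none w hinit hsel] at hv; exact absurd hv (by simp)
        | some b =>
          rw [hx, outU_sel w hinit hsel] at hv
          obtain ⟨i, hiU, hvi⟩ := meetsU_eq_true_iff.1 hv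
          have hb : τ b = some true := (sel_revealedTrue (boxGraphT Λ) enc hsel).1
          obtain ⟨ho, -, hIH⟩ := pathIn_of_run w n b hb
          rw [← hx] at hIH
          -- `b` was examined at some step `k_b < n`; the oracle read its run usable set
          obtain ⟨kb, hkb, hbR⟩ := exists_step_of_run_ne_none (boxGraphT Λ) enc o x n b
            (by show τ b ≠ none; rw [hb]; simp)
          have hUb : usableAt υ Λ enc o w τ b = usableX υ Λ enc o w x (kb + 1) b := usableAt_run w x hkb hbR
          rw [hUb] at hiU
          obtain ⟨hbi, hpi⟩ := hIH kb hbR i hiU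
          have hbv : triGraph.Adj b.1 v.1 := by
            have := rule_eq_filter_of_sel (boxGraphT Λ) enc o hinit hsel
            rw [this, mem_filter] at hvR
            exact (boxGraphT_adj Λ).1 hvR.2.1
          -- `(o,i₀) ⟶ (b,i) ⟶ (v,i)`
          have hvi' : PathIn (lfib FA) (cfgU Λ w) (o.1, i₀) (v.1, i) :=
            hpi.tail ((lfib_adj FA).2 (Or.inl ⟨hbv, rfl⟩)) (mk_mem_cfgU_iff.2 hvi)
          refine ⟨ho, ⟨i, hvi'⟩, fun k hvk j hj => ?_⟩
          rw [hk k hvk, usableX_succ_of_sel w x hvR hinit hsel, usableX_stable w x hbR n (by omega)] at hj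
          refine ⟨hυ₁ _ _ _ hj, ?_⟩
          obtain ⟨i', hi'U, hvi'', hrtg⟩ := hυ₂ _ _ _ hj
          obtain ⟨-, hpi'⟩ := hIH kb hbR i' hi'U
          have h1 : PathIn (lfib FA) (cfgU Λ w) (o.1, i₀) (v.1, i') :=
            hpi'.tail ((lfib_adj FA).2 (Or.inl ⟨hbv, rfl⟩)) (mk_mem_cfgU_iff.2 hvi'')
          exact h1.trans (pathIn_fibre FA hvi'' hrtg)
    · rw [if_neg hvR] at hv
      exact pathIn_of_run w n v hv

/-- **If the payoff of the final state is `1`, an open `𝕋 × F`-path joins `(o, i₀)` to the fibre of a target site.** -/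
theorem exists_pathIn_of_reach (w : ↥Λ → (Φ → Bool)) (B : Finset ↥Λ) (ω₀ : ↥Λ → Bool)
    (h : reachIndicator (boxGraphT Λ) o B
      (merge (run (rule (boxGraphT Λ) enc o) (outU υ Λ enc o w) (Fintype.card ↥Λ + 1)) ω₀) = 1) :
    ∃ v ∈ B, ∃ j : Φ, PathIn (lfib FA) (cfgU Λ w) (o.1, i₀) (v.1, j) := by
  set σ := run (rule (boxGraphT Λ) enc o) (outU υ Λ enc o w) (Fintype.card ↥Λ + 1) with hσ
  have hex : ∃ v ∈ B, OpenPath (boxGraphT Λ) o (merge σ ω₀) v := by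
    by_contra hne
    unfold reachIndicator at h
    rw [if_neg hne] at h
    exact zero_ne_one h
  obtain ⟨v, hvB, hp⟩ := hex
  have hterm : rule (boxGraphT Λ) enc o σ = ∅ := rule_run_card_succ (boxGraphT Λ) enc o _
  have ho : σ o ≠ none := run_root_ne_none (boxGraphT Λ) enc o _ _ (Nat.le_add_left 1 _)
  have hne : ¬ ∀ u, σ u = none := fun hall => ho (hall o)
  have hv : σ v = some true := mem_revealedTrue_of_openPath (boxGraphT Λ) enc o hne hterm ho hp
  obtain ⟨-, ⟨j, hj⟩, -⟩ := pathIn_of_run i₀ hυ₁ hυ₂ hconn w _ v hv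
  exact ⟨v, hvB, j, hj⟩

end Sound

end UFib

end Summit.CriticalPhenomena.PercolationContinuityZ3.Theorems.Pcint

end
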